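import Literature.AnabelianGeometry.EtaleTheta.Discharge.Sec1ThetaCompanionOfAut
import Literature.AnabelianGeometry.EtaleTheta.ThetaCyclotomes
import Mathlib.GroupTheory.Commutator.Basic

/-!
# [EtTh] Prop. 2.2 (i), group-theoretic core: an inversion acts by `+1` on `Δ_Θ`

S. Mochizuki, *The étale theta function and its Frobenioid-theoretic manifestations*, Publ. RIMS **45** (2009):
§2 p. 36 (PRIMS p. 262) «`ι` … the automorphism … determined by “multiplication by `−1`” on the underlying elliptic curve»;
Prop. 2.2 (i) p. 37 (PRIMS p. 263) «The conjugation action of `ι` on the rank two `(ℤ/lℤ)`-module `Δ_X̲` determines a direct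
product decomposition `Δ_X̲ ≅ Δ^ell_X̲ × Δ_Θ` into eigenspaces, with eigenvalues `−1` and `1`, respectively»; §1 p. 12
(`Δ^Θ_X = Δ_X/[Δ_X,[Δ_X,Δ_X]]`, `Δ_Θ = Im(∧² Δ^ell_X)`). [cite: MochizukiEtTh2009, Prop 2.2 (i) p.37]

PROOF-ONLY companion (cell abc-iut, wave-4 seat abc-iut-w4-d014; NO definitions, NO `Prop`-valued facts) to
abc-iut-w5-d072's `Discharge/Sec1ThetaCompanionOfAut.lean` (the theta companion `ι^Θ` of an automorphism `ι` of
`Π^tp_X`, p416913) over abc-iut-L2-t1's root `ThetaSetting` (`Setting.lean`: `ker_toTheta`, `ker_toEll` are the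
`toHat`-preimages of the closures of `[[Δ_X,Δ_X],Δ_X]`, `[Δ_X,Δ_X]` in `Π_X`). GAP row G-w4d010-2, disposition
D-G-w4d010-2g facet **(R1e)** «`ι^Θ ≡ +1` on `Δ_Θ/l·Δ_Θ`» (the binder `hβ` of abc-iut-L2-t8's `hroot_of_coeffChange_root`
p416087 / abc-iut-w4-d010's `prop22_ii'_model_of_thetaKummer` p417690): it is DERIVED here — integrally, not only
mod `l` — from the more primitive geometric input **(R1e′)** «`ι̂` acts as `−1` on `Δ_X^ab`»:
`∀ g ∈ Δ_X, ι̂(g)·g ∈ closure [Δ_X, Δ_X]` (`ι̂ =` d072's `completionAut ι`, the automorphism of `Π_X` extending `ι`).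
* §1 `InversionOnCommutators.*` — GROUP THEORY (any topological group `G`, closed subgroup `H`, topological
  automorphism `σ`): if `σ(g)·g ∈ closure ⁅H,H⁆` for `g ∈ H` then `σ(c)·c⁻¹ ∈ closure ⁅⁅H,H⁆,H⁆` for `c ∈ closure ⁅H,H⁆`
  (`mul_inv_mem_closure_commutator₃_of_inversion`): the fixed set is a closed subgroup of `H` containing every
  commutator by the class-two identity `⁅a·g⁻¹, b·h⁻¹⁆ = ⁅g⁻¹, h⁻¹⁆ = ⁅g, h⁆` in `H/(closure ⁅⁅H,H⁆,H⁆ ∩ H)` (`a`, `b`,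
  `⁅g,h⁆` central there) — this IS «`Δ_Θ ≅ ∧² Δ^ell`, `(−1)·(−1) = +1`».
* §2 `TemperedCurve.completionAut_mul_inv_mem_closure_commutator₃_of_inversion` — at `G := Π_X`, `H := Δ_X`, `σ := ι̂`.
* §3 `ThetaSetting.toTheta_apply_eq_of_inversion` — `(ι x)^Θ = x^Θ` whenever `x^Θ ∈ Δ_Θ`;
  `ThetaCompanion.thetaIso_apply_eq_self_of_inversion` — EVERY theta companion `c` of `ι` (abc-iut-L2-t1's
  `ThetaCompanion`, [EtTh] Thm. 1.6 (ii) shape; in particular d072's `thetaCompanionOfAut`) FIXES `Δ_Θ` pointwise;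
  `ThetaCompanion.thetaIso_mul_inv_mem_lDeltaTheta_of_inversion` — hence the binder `hβ`
  («`ι^Θ(a)·a⁻¹ ∈ l·Δ_Θ` for `a ∈ Δ_Θ`», the `ℤ/l` form printed in Prop. 2.2 (i)) for every `l`.
Honest framing: (R1e′) stays a HYPOTHESIS about the datum `ι` (print: `ι` is induced by `[−1]` on the elliptic curve, which
acts by `−1` on `T(E) ≅ Δ_X^ab`); [EtTh] is refereed and undisputed; nothing here bears on [IUTchIII] Cor. 3.12. typed ≠ proved.
-/

namespace Literature.AnabelianGeometry.EtaleTheta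

namespace InversionOnCommutators

open scoped commutatorElement

/-! ### Pure group algebra -/

/-- In a group: if `⁅g, h⁆` is central then `⁅g⁻¹, h⁻¹⁆ = ⁅g, h⁆` (class-two identity). [folklore] -/
private theorem commutatorElement_inv_inv_of_central {Q : Type*} [Group Q] (g h : Q)
    (hz : ∀ x : Q, ⁅g, h⁆ * x = x * ⁅g, h⁆) : ⁅g⁻¹, h⁻¹⁆ = ⁅g, h⁆ := by
  obtain ⟨z, hzdef⟩ : ∃ z : Q, ⁅g, h⁆ = z := ⟨_, rfl⟩
  rw [hzdef] at hz ⊢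
  have hgh : g * h = z * h * g := by
    rw [← hzdef, commutatorElement_def]; group
  calc ⁅g⁻¹, h⁻¹⁆ = g⁻¹ * h⁻¹ * (g * h) := by rw [commutatorElement_def]; group
    _ = g⁻¹ * h⁻¹ * (z * h * g) := by rw [hgh]
    _ = (g⁻¹ * h⁻¹ * z) * (h * g) := by group
    _ = (z * (g⁻¹ * h⁻¹)) * (h * g) := by rw [← hz (g⁻¹ * h⁻¹)]
    _ = z := by group

/-- In a group: if `A`, `B` are central then `⁅A·g⁻¹, B·h⁻¹⁆ = ⁅g⁻¹, h⁻¹⁆`. [folklore] -/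
private theorem commutatorElement_central_mul_inv {Q : Type*} [Group Q] (A B g h : Q)
    (hA : ∀ x : Q, A * x = x * A) (hB : ∀ x : Q, B * x = x * B) :
    ⁅A * g⁻¹, B * h⁻¹⁆ = ⁅g⁻¹, h⁻¹⁆ := by
  have hu : ∀ y : Q, (A * g⁻¹) * y * (A * g⁻¹)⁻¹ = g⁻¹ * y * g := fun y => by
    rw [mul_inv_rev, inv_inv, show A * g⁻¹ * y * (g * A⁻¹) = A * (g⁻¹ * y * g) * A⁻¹ by group, hA,
      mul_inv_cancel_right]
  have hv : B * (h⁻¹ * g * h) * B⁻¹ = h⁻¹ * g * h := by rw [hB, mul_inv_cancel_right]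
  calc ⁅A * g⁻¹, B * h⁻¹⁆ = (A * g⁻¹) * (B * h⁻¹) * (A * g⁻¹)⁻¹ * (B * h⁻¹)⁻¹ := commutatorElement_def _ _
    _ = g⁻¹ * (B * h⁻¹) * g * (B * h⁻¹)⁻¹ := by rw [hu]
    _ = g⁻¹ * (B * (h⁻¹ * g * h) * B⁻¹) := by group
    _ = g⁻¹ * (h⁻¹ * g * h) := by rw [hv]
    _ = ⁅g⁻¹, h⁻¹⁆ := by rw [commutatorElement_def]; group

/-! ### Subgroup bookkeeping: `H` normalises `⁅H,H⁆`, `⁅⁅H,H⁆,H⁆` and their closures -/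

section Algebra

variable {G : Type*} [Group G] (H : Subgroup G)

/-- Conjugation by an element of `H` maps `H` onto itself. [folklore] -/
private theorem map_conj_eq_self {h : G} (hh : h ∈ H) : H.map (MulAut.conj h).toMonoidHom = H := by
  ext x
  constructor
  · rintro ⟨y, hy, rfl⟩
    simpa [MulAut.conj_apply] using H.mul_mem (H.mul_mem hh hy) (H.inv_mem hh)
  · intro hx
    exact ⟨h⁻¹ * x * h, H.mul_mem (H.mul_mem (H.inv_mem hh) hx) hh, by simp [MulAut.conj_apply, mul_assoc]⟩

/-- `⁅H, H⁆ ≤ H`. [folklore] -/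
private theorem commutator_le_self : ⁅H, H⁆ ≤ H :=
  Subgroup.commutator_le.mpr fun g hg k hk => by
    rw [commutatorElement_def]
    exact H.mul_mem (H.mul_mem (H.mul_mem hg hk) (H.inv_mem hg)) (H.inv_mem hk)

/-- `H` normalises `⁅H, H⁆`. [folklore] -/
private theorem conj_mem_commutator {h x : G} (hh : h ∈ H) (hx : x ∈ ⁅H, H⁆) : h * x * h⁻¹ ∈ ⁅H, H⁆ := by
  have hmap : (⁅H, H⁆).map (MulAut.conj h).toMonoidHom = ⁅H, H⁆ := by
    rw [Subgroup.map_commutator, map_conj_eq_self H hh]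
  have hx' : (MulAut.conj h).toMonoidHom x ∈ (⁅H, H⁆).map (MulAut.conj h).toMonoidHom :=
    Subgroup.mem_map_of_mem _ hx
  rw [hmap] at hx'
  simpa [MulAut.conj_apply] using hx'

/-- `H` normalises `⁅⁅H, H⁆, H⁆`. [folklore] -/
private theorem conj_mem_commutator₃ {h x : G} (hh : h ∈ H) (hx : x ∈ ⁅⁅H, H⁆, H⁆) : h * x * h⁻¹ ∈ ⁅⁅H, H⁆, H⁆ := by
  have hmap : (⁅⁅H, H⁆, H⁆).map (MulAut.conj h).toMonoidHom = ⁅⁅H, H⁆, H⁆ := by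
    rw [Subgroup.map_commutator, Subgroup.map_commutator, map_conj_eq_self H hh]
  have hx' : (MulAut.conj h).toMonoidHom x ∈ (⁅⁅H, H⁆, H⁆).map (MulAut.conj h).toMonoidHom :=
    Subgroup.mem_map_of_mem _ hx
  rw [hmap] at hx'
  simpa [MulAut.conj_apply] using hx'

end Algebra

section Topology

variable {G : Type*} [Group G] [TopologicalSpace G] [IsTopologicalGroup G] (H : Subgroup G)

/-- For `H` closed: `closure ⁅H, H⁆ ≤ H`. [folklore] -/
private theorem closure_commutator_le_self (hH : IsClosed (H : Set G)) : (⁅H, H⁆).topologicalClosure ≤ H :=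
  Subgroup.topologicalClosure_minimal _ (commutator_le_self H) hH

/-- `H` normalises `closure ⁅⁅H, H⁆, H⁆`. [folklore] -/
private theorem conj_mem_closure_commutator₃ {h n : G} (hh : h ∈ H) (hn : n ∈ (⁅⁅H, H⁆, H⁆).topologicalClosure) :
    h * n * h⁻¹ ∈ (⁅⁅H, H⁆, H⁆).topologicalClosure :=
  map_mem_closure (f := fun x : G => h * x * h⁻¹) (IsTopologicalGroup.continuous_conj h) hn
    fun _ hm => conj_mem_commutator₃ H hh hm

/-- Centrality modulo the closure: `a ∈ closure ⁅H, H⁆`, `k ∈ H` ⇒ `⁅a, k⁆ ∈ closure ⁅⁅H, H⁆, H⁆`. [folklore] -/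
private theorem commutatorElement_mem_closure_commutator₃ {a k : G} (ha : a ∈ (⁅H, H⁆).topologicalClosure)
    (hk : k ∈ H) : ⁅a, k⁆ ∈ (⁅⁅H, H⁆, H⁆).topologicalClosure := by
  have hcont : Continuous fun x : G => x * k * x⁻¹ * k⁻¹ := by fun_prop
  have hsub : ((⁅H, H⁆ : Subgroup G) : Set G) ⊆
      (fun x : G => x * k * x⁻¹ * k⁻¹) ⁻¹' ((⁅⁅H, H⁆, H⁆).topologicalClosure : Set G) := by
    intro x hx
    show x * k * x⁻¹ * k⁻¹ ∈ (⁅⁅H, H⁆, H⁆).topologicalClosure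
    rw [← commutatorElement_def]
    exact Subgroup.le_topologicalClosure _ (Subgroup.commutator_mem_commutator hx hk)
  have hmem := closure_minimal hsub ((Subgroup.isClosed_topologicalClosure _).preimage hcont) ha
  rw [commutatorElement_def]
  exact hmem

/-! ### The theorem -/

/-- **An automorphism acting as `−1` on `H^ab` acts as `+1` on `closure ⁅H,H⁆` modulo `closure ⁅⁅H,H⁆,H⁆`.**
For a closed subgroup `H` of a topological group `G` and a topological automorphism `σ` of `G` with
`σ(g)·g ∈ closure ⁅H, H⁆` for all `g ∈ H`: `σ(c)·c⁻¹ ∈ closure ⁅⁅H, H⁆, H⁆` for all `c ∈ closure ⁅H, H⁆`. (The set of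
such `c` is a closed subgroup of `H`; it contains every commutator `⁅g, h⁆`, `g, h ∈ H`, by the class-two identity
`⁅a·g⁻¹, b·h⁻¹⁆ ≡ ⁅g⁻¹, h⁻¹⁆ ≡ ⁅g, h⁆` in `H / (closure ⁅⁅H,H⁆,H⁆ ∩ H)`, where `a = σ(g)g`, `b = σ(h)h` and `⁅g, h⁆` are
central.) This is the group theory of [EtTh] Prop. 2.2 (i) («eigenvalues `−1` and `1`»: `Δ_Θ ≅ ∧² Δ^ell`).
[cite: MochizukiEtTh2009, Prop 2.2 (i) p.37] -/
theorem mul_inv_mem_closure_commutator₃_of_inversion (hH : IsClosed (H : Set G)) (σ : G ≃ₜ* G)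
    (hinv : ∀ g ∈ H, σ g * g ∈ (⁅H, H⁆).topologicalClosure)
    (c : G) (hc : c ∈ (⁅H, H⁆).topologicalClosure) :
    σ c * c⁻¹ ∈ (⁅⁅H, H⁆, H⁆).topologicalClosure := by
  have hCH : (⁅H, H⁆).topologicalClosure ≤ H := closure_commutator_le_self H hH
  -- coercion of commutators of `↥H`
  have hcoe : ∀ x y : H, ((⁅x, y⁆ : H) : G) = ⁅(x : G), (y : G)⁆ := fun x y =>
    map_commutatorElement H.subtype x y
  -- the quotient of `H` by `closure ⁅⁅H,H⁆,H⁆ ∩ H`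
  let M : Subgroup H := ((⁅⁅H, H⁆, H⁆).topologicalClosure).subgroupOf H
  haveI hM : M.Normal := ⟨fun n hn k => by
    rw [Subgroup.mem_subgroupOf] at hn ⊢
    simpa using conj_mem_closure_commutator₃ H k.2 hn⟩
  let π : H →* H ⧸ M := QuotientGroup.mk' M
  have hker : ∀ x : H, π x = 1 ↔ (x : G) ∈ (⁅⁅H, H⁆, H⁆).topologicalClosure := fun x => by
    rw [QuotientGroup.mk'_apply, QuotientGroup.eq_one_iff, Subgroup.mem_subgroupOf]
  -- images of `closure ⁅H,H⁆` are central in the quotient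
  have hcent : ∀ (a : H), (a : G) ∈ (⁅H, H⁆).topologicalClosure → ∀ y : H ⧸ M, π a * y = y * π a := by
    intro a ha y
    obtain ⟨k, rfl⟩ := QuotientGroup.mk'_surjective M y
    rw [← commutatorElement_eq_one_iff_mul_comm, ← map_commutatorElement, hker, hcoe]
    exact commutatorElement_mem_closure_commutator₃ H ha k.2
  -- the closed subgroup `S := {c ∈ H | σ c · c⁻¹ ∈ closure ⁅⁅H,H⁆,H⁆}`
  let S : Subgroup G :=
    { carrier := {c | c ∈ H ∧ σ c * c⁻¹ ∈ (⁅⁅H, H⁆, H⁆).topologicalClosure}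
      one_mem' := ⟨H.one_mem, by simp⟩
      mul_mem' := fun {c d} hc hd => ⟨H.mul_mem hc.1 hd.1, by
        have e : σ (c * d) * (c * d)⁻¹ = (σ c * c⁻¹) * (c * (σ d * d⁻¹) * c⁻¹) := by
          rw [map_mul]; group
        rw [e]
        exact Subgroup.mul_mem _ hc.2 (conj_mem_closure_commutator₃ H hc.1 hd.2)⟩
      inv_mem' := fun {c} hc => ⟨H.inv_mem hc.1, by
        have e : σ c⁻¹ * c⁻¹⁻¹ = c⁻¹ * (σ c * c⁻¹)⁻¹ * c⁻¹⁻¹ := by rw [map_inv]; group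
        rw [e]
        exact conj_mem_closure_commutator₃ H (H.inv_mem hc.1) (Subgroup.inv_mem _ hc.2)⟩ }
  have hSclosed : IsClosed (S : Set G) := by
    have hcont : Continuous fun c : G => σ c * c⁻¹ := by fun_prop
    exact hH.inter ((Subgroup.isClosed_topologicalClosure _).preimage hcont)
  -- every commutator of `H` lies in `S`
  have hCS : ⁅H, H⁆ ≤ S := by
    refine Subgroup.commutator_le.mpr fun g hg h hh => ⟨commutator_le_self H (Subgroup.commutator_mem_commutator hg hh), ?_⟩
    have ha := hinv g hg
    have hb := hinv h hh
    have haH := hCH ha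
    have hbH := hCH hb
    have hσg : σ g = (σ g * g) * g⁻¹ := (mul_inv_cancel_right _ _).symm
    have hσh : σ h = (σ h * h) * h⁻¹ := (mul_inv_cancel_right _ _).symm
    -- the element as an element of `H`
    let e : H := ⁅(⟨σ g * g, haH⟩ : H) * ⟨g, hg⟩⁻¹, (⟨σ h * h, hbH⟩ : H) * ⟨h, hh⟩⁻¹⁆ * ⁅(⟨g, hg⟩ : H), ⟨h, hh⟩⁆⁻¹
    have he : (e : G) = σ ⁅g, h⁆ * ⁅g, h⁆⁻¹ := by
      rw [map_commutatorElement, hσg, hσh]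
      simp only [e, Subgroup.coe_mul, InvMemClass.coe_inv, hcoe]
    rw [← he, ← hker e]
    simp only [e, map_mul, map_inv, map_commutatorElement]
    rw [commutatorElement_central_mul_inv _ _ _ _ (hcent _ ha) (hcent _ hb),
      commutatorElement_inv_inv_of_central _ _ (fun y => ?_), mul_inv_cancel]
    rw [← map_commutatorElement]
    exact hcent _ (by rw [hcoe]; exact Subgroup.le_topologicalClosure _ (Subgroup.commutator_mem_commutator hg hh)) y
  exact (Subgroup.topologicalClosure_minimal _ hCS hSclosed hc).2

end Topology

end InversionOnCommutators

end Literature.AnabelianGeometry.EtaleTheta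

/-! ## §2. At a tempered curve: `ι̂` on `Δ_X ⊆ Π_X` -/

namespace Literature.AnabelianGeometry.SemiGraphs

namespace TemperedCurve

open scoped commutatorElement
open Literature.AnabelianGeometry.EtaleTheta

variable {p : ℕ} [Fact p.Prime] (X : TemperedCurve p) (α : X.PiTemp ≃ₜ* X.PiTemp)

/-- **If `α̂` acts as `−1` on `Δ_X^ab`, then `α̂` acts as `+1` on `closure [Δ_X,Δ_X]` modulo `closure [[Δ_X,Δ_X],Δ_X]`**
(`Δ_X ⊆ Π_X` is closed: it is the closure of `ι_X(Δ^tp_X)`; `α̂ =` abc-iut-w5-d072's `completionAut α`). This is the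
`Π_X`-level content of [EtTh] Prop. 2.2 (i)'s eigenvalue `+1` on `Δ_Θ`. [cite: MochizukiEtTh2009, Prop 2.2 (i) p.37] -/
theorem completionAut_mul_inv_mem_closure_commutator₃_of_inversion
    (hinv : ∀ g ∈ X.DeltaHat, X.completionAut α g * g ∈ (⁅X.DeltaHat, X.DeltaHat⁆).topologicalClosure)
    (c : X.PiHat) (hc : c ∈ (⁅X.DeltaHat, X.DeltaHat⁆).topologicalClosure) :
    X.completionAut α c * c⁻¹ ∈ (⁅⁅X.DeltaHat, X.DeltaHat⁆, X.DeltaHat⁆).topologicalClosure :=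
  InversionOnCommutators.mul_inv_mem_closure_commutator₃_of_inversion X.DeltaHat
    (by unfold DeltaHat; exact Subgroup.isClosed_topologicalClosure _) (X.completionAut α) hinv c hc

end TemperedCurve

end Literature.AnabelianGeometry.SemiGraphs

/-! ## §3. At the theta setting: `ι^Θ = +1` on `Δ_Θ` -/

namespace Literature.AnabelianGeometry.EtaleTheta

namespace ThetaSetting

open scoped commutatorElement
open Literature.AnabelianGeometry.SemiGraphs Topology

variable {p : ℕ} [Fact p.Prime] (D : ThetaSetting p) (ι : D.PiTemp ≃ₜ* D.PiTemp)
  (hinv : ∀ g ∈ D.toTemperedCurve.DeltaHat, D.toTemperedCurve.completionAut ι g * g ∈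
    (⁅D.toTemperedCurve.DeltaHat, D.toTemperedCurve.DeltaHat⁆).topologicalClosure)

include hinv in
/-- **`(ι x)^Θ = x^Θ` for every `x ∈ Π^tp_X` with `x^Θ ∈ Δ_Θ`**, if `ι̂` acts as `−1` on `Δ_X^ab`: `x^Θ ∈ Δ_Θ` means
`ι_X(x) ∈ closure [Δ_X,Δ_X]` (root field `ker_toEll`), so `ι̂(ι_X x)·ι_X(x)⁻¹ = ι_X((ι x)·x⁻¹) ∈ closure [[Δ_X,Δ_X],Δ_X]`
(§2, `completionAut_toHat`), i.e. `(ι x)·x⁻¹ ∈ Ker(Π^tp_X ↠ (Π^tp_X)^Θ)` (root field `ker_toTheta`).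
[cite: MochizukiEtTh2009, Prop 2.2 (i) p.37] -/
theorem toTheta_apply_eq_of_inversion (x : D.PiTemp) (hx : D.toTheta x ∈ D.DeltaTheta) :
    D.toTheta (ι x) = D.toTheta x := by
  have hx' : x ∈ (D.thetaToEll.comp D.toTheta).ker := by
    rw [MonoidHom.mem_ker, MonoidHom.comp_apply]
    exact hx
  rw [D.ker_toEll, Subgroup.mem_comap] at hx'
  have hmem := D.toTemperedCurve.completionAut_mul_inv_mem_closure_commutator₃_of_inversion ι hinv
    (D.toHat x) hx'
  rw [TemperedCurve.completionAut_toHat] at hmem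
  have hker : ι x * x⁻¹ ∈ D.toTheta.ker := by
    rw [D.ker_toTheta, Subgroup.mem_comap, map_mul, map_inv]
    exact hmem
  rwa [MonoidHom.mem_ker, map_mul, map_inv, mul_inv_eq_one] at hker

variable {ι}

include hinv in
/-- **Every theta companion `ι^Θ` of `ι` FIXES `Δ_Θ` pointwise**, if `ι̂` acts as `−1` on `Δ_X^ab` — the integral form of
[EtTh] Prop. 2.2 (i)'s «eigenvalue `1`» on `Δ_Θ` (`ι^Θ ∘ (·)^Θ = (·)^Θ ∘ ι`, abc-iut-L2-t1's `ThetaCompanion.comm`, and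
`toTheta` is onto; applies in particular to abc-iut-w5-d072's `thetaCompanionOfAut ι hΔ hq`).
[cite: MochizukiEtTh2009, Prop 2.2 (i) p.37] -/
theorem ThetaCompanion.thetaIso_apply_eq_self_of_inversion (c : ThetaCompanion ι) (a : D.GtpTheta)
    (ha : a ∈ D.DeltaTheta) : c.thetaIso a = a := by
  obtain ⟨x, rfl⟩ := D.toTheta_surjective a
  have hcomm : c.thetaIso (D.toTheta x) = D.toTheta (ι x) := (c.comm x).symm
  rw [hcomm]
  exact D.toTheta_apply_eq_of_inversion ι hinv x ha

include hinv in
/-- **The binder `hβ` of the (R2) `hroot` transport, DISCHARGED from (R1e′)**: for every theta companion `ι^Θ` of an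
inversion `ι` acting as `−1` on `Δ_X^ab` and every `a ∈ Δ_Θ`, `ι^Θ(a)·a⁻¹ (= 1) ∈ l·Δ_Θ` — [EtTh] Prop. 2.2 (i)'s
«eigenvalue `1`» on `Δ̄_Θ = Δ_Θ/l·Δ_Θ`, as consumed by abc-iut-L2-t8's `hroot_of_coeffChange_root` (p416087) and
abc-iut-w4-d010's `prop22_ii'_model_of_thetaKummer` (p417690). [cite: MochizukiEtTh2009, Prop 2.2 (i) p.37] -/
theorem ThetaCompanion.thetaIso_mul_inv_mem_lDeltaTheta_of_inversion (c : ThetaCompanion ι) (l : ℕ)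
    (a : D.GtpTheta) (ha : a ∈ D.DeltaTheta) : c.thetaIso a * a⁻¹ ∈ D.lDeltaTheta l := by
  rw [ThetaCompanion.thetaIso_apply_eq_self_of_inversion D hinv c a ha, mul_inv_cancel]
  exact one_mem _

end ThetaSetting

end Literature.AnabelianGeometry.EtaleTheta
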